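import Summits.Ventures.YMGap.RobustBall.LoopActionMember
import HarnessLib

/-!
# Venture YMGap, track ROBUST-BALL (tier 2) — the loop-action norm ball IS a norm ball: linearity of the action in
# the couplings, subadditivity, homogeneity, solidity and weight-monotonicity of `LoopNormLE`

HONEST FRAMING. WHAT THIS IS: a venture file (cell `pub-ymgap`, track Y2 ROBUST-BALL, seat rb-p1) recording in the
kernel the structural facts behind the words "weighted non-local Banach norm ball" for `LoopNormLE` of
`LoopActionMember.lean` (fixed loop family `γ`, couplings varying): the action is LINEAR in the couplings
(`loopFamilyAction_add`, `loopFamilyAction_smul`, `loopFamilyAction_zero`); the per-link weights are subadditive and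
absolutely homogeneous (`loopWeightAt_add_le`, `loopWeightAt_smul`); hence the radius-`ε` sets are the balls of a
seminorm: `LoopNormLE.add` (radii add), `LoopNormLE.smul` (radius scales by `|a|`), `LoopNormLE.zero`, convexity
(`LoopNormLE.convex`), solidity (`LoopNormLE.of_abs_le`: domination `|c'| ≤ |c|` termwise), and monotonicity in the
weight rate (`LoopNormLE.weight_mono`) and in the radius (`LoopNormLE.mono`, already in `LoopActionMember.lean`).
WHAT IT IS NOT: no measure, no new cell; nothing about the continuum limit or the Clay problem.

References: this track's `LoopActionMember.lean`; `BallClosure.lean` (the analogous facts for `MemBallZdS`).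
-/

noncomputable section

open MeasureTheory Function Real
open Literature.Probability.LatticeModels
open Literature.MathematicalPhysics.QuantumLattice
open Literature.MathematicalPhysics.QuantumFieldTheory (walkEdges)

namespace Summit.Ventures.YMGap.RobustBall

variable {d N : ℕ} {ι : Type*} {γ : ι → ZdLoop d} {c c' : ι → ℝ} {w ε ε' : ℝ}

/-! ### Linearity of the action in the couplings -/

section Linear

/-- The loop term is linear in its coupling: additivity. -/
theorem loopTerm_add {x : Site d} (a b : ℝ) (p : (zdGraph d).Walk x x) (U : LGConfig d (SUN N)) :
    loopTerm N (a + b) p U = loopTerm N a p U + loopTerm N b p U := by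
  simp only [loopTerm_apply, add_mul]

/-- The loop term is linear in its coupling: homogeneity. -/
theorem loopTerm_smul {x : Site d} (a b : ℝ) (p : (zdGraph d).Walk x x) (U : LGConfig d (SUN N)) :
    loopTerm N (a * b) p U = a * loopTerm N b p U := by
  simp only [loopTerm_apply, mul_assoc]

/-- The loop term with zero coupling vanishes. -/
theorem loopTerm_zero {x : Site d} (p : (zdGraph d).Walk x x) (U : LGConfig d (SUN N)) : loopTerm N 0 p U = 0 := by
  simp only [loopTerm_apply, zero_mul]

/-- **The loop-family action is additive in the couplings.** -/
theorem loopFamilyAction_add (γ : ι → ZdLoop d) (c c' : ι → ℝ) :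
    loopFamilyAction (d := d) N γ (fun i => c i + c' i) = loopFamilyAction N γ c + loopFamilyAction N γ c' := by
  funext X U
  simp only [loopFamilyAction, Pi.add_apply, indexedPotential_apply, loopTerm_add, Finset.sum_add_distrib]

/-- **The loop-family action is homogeneous in the couplings.** -/
theorem loopFamilyAction_smul (γ : ι → ZdLoop d) (a : ℝ) (c : ι → ℝ) :
    loopFamilyAction (d := d) N γ (fun i => a * c i) = a • loopFamilyAction N γ c := by
  funext X U
  simp only [loopFamilyAction, Pi.smul_apply, smul_eq_mul, indexedPotential_apply, loopTerm_smul, Finset.mul_sum]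

/-- The action with zero couplings is the zero potential (the Wilson action itself). -/
theorem loopFamilyAction_zero (γ : ι → ZdLoop d) : loopFamilyAction (d := d) N γ (fun _ => 0) = 0 := by
  funext X U
  simp only [loopFamilyAction, indexedPotential_apply, loopTerm_zero, Finset.sum_const_zero, Pi.zero_apply]

end Linear

/-! ### The weights: subadditive, absolutely homogeneous, solid, weight-monotone -/

section Weights

/-- Subadditivity of the weights in the couplings. -/
theorem loopWeightAt_add_le (w : ℝ) (γ : ι → ZdLoop d) (c c' : ι → ℝ) (e : ZdEdge d) (i : ι) :
    loopWeightAt w γ (fun i => c i + c' i) e i ≤ loopWeightAt w γ c e i + loopWeightAt w γ c' e i := by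
  unfold loopWeightAt
  split_ifs with he
  · rw [← add_mul]
    exact mul_le_mul_of_nonneg_right (abs_add_le _ _) (Finset.sum_nonneg fun y _ => by positivity)
  · simp

/-- Absolute homogeneity of the weights. -/
theorem loopWeightAt_smul (w : ℝ) (γ : ι → ZdLoop d) (a : ℝ) (c : ι → ℝ) (e : ZdEdge d) (i : ι) :
    loopWeightAt w γ (fun i => a * c i) e i = |a| * loopWeightAt w γ c e i := by
  unfold loopWeightAt
  split_ifs
  · rw [abs_mul, mul_assoc]
  · rw [mul_zero]

/-- Solidity: termwise domination of the couplings dominates the weights. -/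
theorem loopWeightAt_mono_abs (w : ℝ) (γ : ι → ZdLoop d) (h : ∀ i, |c' i| ≤ |c i|) (e : ZdEdge d) (i : ι) :
    loopWeightAt w γ c' e i ≤ loopWeightAt w γ c e i := by
  unfold loopWeightAt
  split_ifs
  · exact mul_le_mul_of_nonneg_right (h i) (Finset.sum_nonneg fun y _ => by positivity)
  · exact le_rfl

/-- Monotonicity of the weights in the rate `w`. -/
theorem loopWeightAt_weight_mono {w w' : ℝ} (hw : w' ≤ w) (γ : ι → ZdLoop d) (c : ι → ℝ) (e : ZdEdge d) (i : ι) :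
    loopWeightAt w' γ c e i ≤ loopWeightAt w γ c e i := by
  unfold loopWeightAt
  split_ifs
  · refine mul_le_mul_of_nonneg_left (Finset.sum_le_sum fun y _ => ?_) (abs_nonneg _)
    exact mul_le_mul_of_nonneg_left (exp_le_exp.2 (mul_le_mul_of_nonneg_right hw (norm_nonneg _))) (Nat.cast_nonneg _)
  · exact le_rfl

end Weights

/-! ### The norm ball: seminorm properties -/

section Ball

/-- A dominated nonnegative-weight comparison principle for `LoopNormLE`. -/
theorem LoopNormLE.of_weight_le {γ' : ι → ZdLoop d} {w' : ℝ} (h : LoopNormLE w γ c ε)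
    (hle : ∀ e i, loopWeightAt w' γ' c' e i ≤ loopWeightAt w γ c e i) : LoopNormLE w' γ' c' ε :=
  ⟨h.nonneg, fun e => (h.summable e).of_nonneg_of_le (loopWeightAt_nonneg _ _ _ e) (hle e), fun e =>
    (Summable.tsum_le_tsum (hle e) ((h.summable e).of_nonneg_of_le (loopWeightAt_nonneg _ _ _ e) (hle e))
      (h.summable e)).trans (h.tsum_le e)⟩

/-- **The zero coupling is in every ball** (`ε ≥ 0`). -/
theorem LoopNormLE.zero (hε : 0 ≤ ε) (w : ℝ) (γ : ι → ZdLoop d) : LoopNormLE w γ (fun _ => (0 : ℝ)) ε := by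
  have h0 : ∀ e i, loopWeightAt w γ (fun _ => (0 : ℝ)) e i = 0 := fun e i => by
    unfold loopWeightAt; split_ifs <;> simp
  refine ⟨hε, fun e => ?_, fun e => ?_⟩
  · exact (summable_zero).congr fun i => (h0 e i).symm
  · rw [tsum_congr (h0 e), tsum_zero]; exact hε

/-- **Subadditivity (radii add)**: `‖c‖ ≤ ε`, `‖c'‖ ≤ ε'` ⇒ `‖c + c'‖ ≤ ε + ε'`. -/
theorem LoopNormLE.add (h : LoopNormLE w γ c ε) (h' : LoopNormLE w γ c' ε') :
    LoopNormLE w γ (fun i => c i + c' i) (ε + ε') := by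
  have hle := loopWeightAt_add_le w γ c c'
  refine ⟨add_nonneg h.nonneg h'.nonneg, fun e => ?_, fun e => ?_⟩
  · exact ((h.summable e).add (h'.summable e)).of_nonneg_of_le (loopWeightAt_nonneg _ _ _ e) (hle e)
  · calc ∑' i, loopWeightAt w γ (fun i => c i + c' i) e i
        ≤ ∑' i, (loopWeightAt w γ c e i + loopWeightAt w γ c' e i) :=
          Summable.tsum_le_tsum (hle e)
            (((h.summable e).add (h'.summable e)).of_nonneg_of_le (loopWeightAt_nonneg _ _ _ e) (hle e))
            ((h.summable e).add (h'.summable e))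
      _ = ∑' i, loopWeightAt w γ c e i + ∑' i, loopWeightAt w γ c' e i := (h.summable e).tsum_add (h'.summable e)
      _ ≤ ε + ε' := add_le_add (h.tsum_le e) (h'.tsum_le e)

/-- **Absolute homogeneity**: `‖c‖ ≤ ε ⇒ ‖a c‖ ≤ |a| ε`. -/
theorem LoopNormLE.smul (h : LoopNormLE w γ c ε) (a : ℝ) : LoopNormLE w γ (fun i => a * c i) (|a| * ε) := by
  refine ⟨mul_nonneg (abs_nonneg a) h.nonneg, fun e => ?_, fun e => ?_⟩
  · exact ((h.summable e).mul_left |a|).congr fun i => (loopWeightAt_smul w γ a c e i).symm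
  · calc ∑' i, loopWeightAt w γ (fun i => a * c i) e i = ∑' i, |a| * loopWeightAt w γ c e i :=
          tsum_congr fun i => loopWeightAt_smul w γ a c e i
      _ = |a| * ∑' i, loopWeightAt w γ c e i := tsum_mul_left
      _ ≤ |a| * ε := mul_le_mul_of_nonneg_left (h.tsum_le e) (abs_nonneg a)

/-- **Convexity of the ball**: `‖c‖, ‖c'‖ ≤ ε`, `0 ≤ t ≤ 1` ⇒ `‖(1 − t) c + t c'‖ ≤ ε`. -/
theorem LoopNormLE.convex (h : LoopNormLE w γ c ε) (h' : LoopNormLE w γ c' ε) {t : ℝ} (ht0 : 0 ≤ t) (ht1 : t ≤ 1) :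
    LoopNormLE w γ (fun i => (1 - t) * c i + t * c' i) ε := by
  have h1 := (h.smul (1 - t)).add (h'.smul t)
  rw [abs_of_nonneg (by linarith), abs_of_nonneg ht0, show (1 - t) * ε + t * ε = ε by ring] at h1
  exact h1

/-- **Solidity**: termwise `|c'_i| ≤ |c_i|` and `‖c‖ ≤ ε` give `‖c'‖ ≤ ε`. -/
theorem LoopNormLE.of_abs_le (h : LoopNormLE w γ c ε) (hle : ∀ i, |c' i| ≤ |c i|) : LoopNormLE w γ c' ε :=
  h.of_weight_le fun e i => loopWeightAt_mono_abs w γ hle e i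

/-- **Weight monotonicity**: a ball at rate `w` is inside the ball of the same radius at any slower rate `w' ≤ w`. -/
theorem LoopNormLE.weight_mono (h : LoopNormLE w γ c ε) {w' : ℝ} (hw : w' ≤ w) : LoopNormLE w' γ c ε :=
  h.of_weight_le fun e i => loopWeightAt_weight_mono hw γ c e i

/-- **Negation**: `‖−c‖ = ‖c‖`. -/
theorem LoopNormLE.neg (h : LoopNormLE w γ c ε) : LoopNormLE w γ (fun i => -c i) ε :=
  h.of_abs_le fun i => by rw [abs_neg]

end Ball

end Summit.Ventures.YMGap.RobustBall

end
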